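import Summits.BirchSwinnertonDyer.BirchSwinnertonDyer.Theorems.SylvesterTwoHeegnerIndexUpperDescentSylvester
import HarnessLib

/-!
# K7t crux `UpperOffV0HSYPlus` (item 19804), line `offv0-kolyvagin2`, input of stub (d) at `p = 2`:
# `E_p(L)[2] = 0` for every NORMAL extension `L/ℚ` not containing `ω`

Helper file of route `SylvesterTwoHeegnerIndex` (cell bsd-cm, rung K7t); sequel of k7t-c2 g0's
`…UpperDescentSylvester` (`E_p(F)[2] = 0` for `[F : ℚ] = 2`).  Kolyvagin's derivative classes
(stub (d) `stub_kolyvaginClasses_two`) need ADMISSIBLE subgroups `A_m = E(K_m)` — Galois-stable and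
without `2^M`-torsion — at every Kolyvagin level `m` (Gross 1991, Lemma 4.3: «`E` has no `K_n`-rational
`p`-torsion», there from `ρ̄_{E,p}` onto; McCallum 1991, (5)).  At `p = 2` for the Sylvester curves the
replacement is field-theoretic: the ring class fields `K_m` are normal over `ℚ` and do not contain `ω`
(`3 ∤ m`, `3` split in `K`: `K(√−3)/K` is ramified at `3`, `K_m/K` is not), and

* `two_torsion_eq_zero_cubeSumCurve_of_no_cube_root` / `two_torsion_eq_zero_of_model_of_no_cube_root` —
  over ANY field `F ⊇ ℚ` in which `432p²` is not a cube, every model of `E_p` has `E_p(F)[2] = 0`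
  (a `2`-torsion point of `y² = x³ − 432p²` is `(x, 0)` with `x³ = 432p²`);
* `exists_sq_add_self_add_one_eq_zero_of_cube_eq` — in a NORMAL extension `L/ℚ`, a cube root of
  `432p²` forces `ω ∈ L`: `X³ − 432p²` is irreducible over `ℚ` (g0), hence is the minimal polynomial of
  the root, splits in `L` by normality with three distinct roots (separable), and the ratio of two
  distinct roots is a primitive cube root of unity;
* `two_torsion_eq_zero_of_model_of_normal` — **for every model `W` of `E_p` (`p` an odd prime) and
  every normal `L/ℚ` with `ω ∉ L`: `W(L)[2] = 0`** — the admissibility input of (d) at the Kolyvagin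
  levels, modulo «`ω ∉ K_m`» (ring-class-field ramification, not in this file).

THEOREMS ONLY (no definition, no named fact, no `sorry`); closes nothing; B14 = O12 open as a class.
References: [GrossLMS1991] Lemma 4.3; [McCallumLMS1991] §4 (5); [SilvermanAEC2009] III.2.3;
Mathlib `X_pow_sub_C_irreducible_of_prime`, `Normal.splits`, `separable_X_pow_sub_C`.
-/

set_option autoImplicit false
set_option linter.dupNamespace false

noncomputable section

open scoped Classical Polynomial

universe u

open Literature.NumberTheory.EllipticCurves Literature.NumberTheory.EllipticCurves.HuShuYin2019
  WeierstrassCurve Polynomial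

namespace Summit.BirchSwinnertonDyer.BirchSwinnertonDyer.Theorems.SylvesterTwoUpper

/-! ## §1 No `2`-torsion over a field without a cube root of `432p²` -/

/-- **`E_p(F)[2] = 0` on the cube-sum model whenever `432p²` is not a cube in `F`**: a `2`-torsion
point `(x, y)` of `y² = x³ − 432p²` has `y = −y`, so `y = 0` and `x³ = 432p²`.
[cite: SilvermanAEC2009, III.2.3 (negation formula)] -/
theorem two_torsion_eq_zero_cubeSumCurve_of_no_cube_root (p : ℕ)
    (F : Type u) [Field F] [CharZero F] [Algebra ℚ F]
    (hF : ∀ x : F, x ^ 3 ≠ algebraMap ℚ F (432 * (p : ℚ) ^ 2))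
    (Q : ((cubeSumCurve (p : ℚ)).baseChange F).toAffine.Point) (hQ : 2 • Q = 0) : Q = 0 := by
  rcases Q with _ | ⟨x, y, h⟩
  · rfl
  · exfalso
    have hneg : (Affine.Point.some x y h : ((cubeSumCurve (p : ℚ)).baseChange F).toAffine.Point)
        = -Affine.Point.some x y h := by
      rw [← add_eq_zero_iff_eq_neg, ← two_nsmul]; exact hQ
    rw [Affine.Point.neg_some, Affine.Point.some.injEq] at hneg
    have hy : y = 0 := by
      have h2 : y = -y := by
        have := hneg.2
        simpa [Affine.negY, cubeSumCurve, WeierstrassCurve.baseChange] using this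
      have h3 : (2 : F) * y = 0 := by linear_combination h2
      simpa using h3
    have heq := (Affine.equation_iff x y).mp h.1
    simp [cubeSumCurve, WeierstrassCurve.baseChange, hy] at heq
    apply hF x
    rw [map_mul, map_pow, map_natCast]
    norm_num
    linear_combination -heq

/-- **`E_p(F)[2] = 0` for EVERY model** of `E_p` over a field `F ⊇ ℚ` in which `432p²` is not a cube
(transport along `VariableChange.pointEquiv`). [cite: SilvermanAEC2009, III.3.1(b)] -/
theorem two_torsion_eq_zero_of_model_of_no_cube_root (p : ℕ)
    (W : WeierstrassCurve ℚ) (hW : ∃ C : VariableChange ℚ, C • W = cubeSumCurve (p : ℚ))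
    (F : Type u) [Field F] [CharZero F] [Algebra ℚ F]
    (hF : ∀ x : F, x ^ 3 ≠ algebraMap ℚ F (432 * (p : ℚ) ^ 2))
    (Q : (W.baseChange F).toAffine.Point) (hQ : 2 • Q = 0) : Q = 0 := by
  obtain ⟨C, hC⟩ := hW
  have heq : (C.map (algebraMap ℚ F)) • (W.baseChange F) = (cubeSumCurve (p : ℚ)).baseChange F := by
    rw [WeierstrassCurve.baseChange, WeierstrassCurve.map_variableChange, hC]; rfl
  have htarget : ∀ R : ((C.map (algebraMap ℚ F)) • (W.baseChange F)).toAffine.Point,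
      2 • R = 0 → R = 0 := by
    rw [heq]; exact two_torsion_eq_zero_cubeSumCurve_of_no_cube_root p F hF
  exact SylvesterTwoLower.two_smul_eq_zero_imp_of_addEquiv
    (VariableChange.pointEquiv (W.baseChange F) (C.map (algebraMap ℚ F))).symm htarget Q hQ

/-! ## §2 In a normal extension of `ℚ`, a cube root of `432p²` forces `ω` -/

/-- **A cube root of `432p²` in a NORMAL extension `L/ℚ` forces a primitive cube root of unity in `L`.**
`X³ − 432p²` is irreducible over `ℚ` (`p` an odd prime), so it is the minimal polynomial of any root
`x ∈ L`; by normality it splits in `L`, with three distinct roots (it is separable in characteristic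
`0`, `432p² ≠ 0`); for a second root `r ≠ x`, `w = r/x` has `w³ = 1`, `w ≠ 1`, hence `w² + w + 1 = 0`.
[folklore] -/
theorem exists_sq_add_self_add_one_eq_zero_of_cube_eq {p : ℕ} (hp : p.Prime) (hp2 : p ≠ 2)
    (L : Type u) [Field L] [Algebra ℚ L] [Normal ℚ L] {x : L}
    (hx : x ^ 3 = algebraMap ℚ L (432 * (p : ℚ) ^ 2)) : ∃ w : L, w ^ 2 + w + 1 = 0 := by
  haveI : CharZero L := charZero_of_injective_algebraMap (algebraMap ℚ L).injective
  set a : ℚ := 432 * (p : ℚ) ^ 2 with ha_def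
  have ha : a ≠ 0 := by
    have : (p : ℚ) ≠ 0 := by exact_mod_cast hp.ne_zero
    positivity
  have haL : algebraMap ℚ L a ≠ 0 := by
    rw [Ne, map_eq_zero_iff _ (algebraMap ℚ L).injective]; exact ha
  have hx0 : x ≠ 0 := by
    rintro rfl
    apply haL
    rw [← hx]; ring
  -- the minimal polynomial of `x` is `X³ − a`
  have hmonic : (X ^ 3 - C a : ℚ[X]).Monic := monic_X_pow_sub_C _ (by norm_num)
  have haeval : aeval x (X ^ 3 - C a : ℚ[X]) = 0 := by
    simp only [map_sub, map_pow, aeval_X, aeval_C, hx, sub_self]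
  have hmin : minpoly ℚ x = X ^ 3 - C a :=
    (minpoly.eq_of_irreducible_of_monic (irreducible_X_pow_three_sub hp hp2) haeval hmonic).symm
  -- it splits in `L` by normality
  set g : L[X] := (X ^ 3 - C a : ℚ[X]).map (algebraMap ℚ L) with hg_def
  have hg : g = X ^ 3 - C (algebraMap ℚ L a) := by
    simp only [hg_def, Polynomial.map_sub, Polynomial.map_pow, map_X, map_C]
  have hspl : Splits g := by
    have h := Normal.splits (inferInstance : Normal ℚ L) x
    rwa [hmin] at h
  have hg0 : g ≠ 0 := by
    rw [hg]; exact X_pow_sub_C_ne_zero (by norm_num) _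
  -- three distinct roots
  have hcard : g.roots.card = 3 := by
    rw [← hspl.natDegree_eq_card_roots, hg, natDegree_X_pow_sub_C]
  have hsep : g.Separable := by
    rw [hg]; exact separable_X_pow_sub_C _ (by norm_num) haL
  have hnodup : g.roots.Nodup := nodup_roots hsep
  have hxroot : x ∈ g.roots.toFinset := by
    rw [Multiset.mem_toFinset, mem_roots hg0, hg, IsRoot, eval_sub, eval_pow, eval_X, eval_C, hx,
      sub_self]
  have hcard' : 1 < g.roots.toFinset.card := by
    rw [Multiset.toFinset_card_of_nodup hnodup, hcard]; norm_num
  obtain ⟨r, hr, hrx⟩ := Finset.exists_mem_ne hcard' x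
  have hr3 : r ^ 3 = algebraMap ℚ L a := by
    rw [Multiset.mem_toFinset, mem_roots hg0, hg, IsRoot, eval_sub, eval_pow, eval_X, eval_C,
      sub_eq_zero] at hr
    exact hr
  -- `w = r / x`
  refine ⟨r / x, ?_⟩
  have hw3 : (r / x) ^ 3 = 1 := by
    rw [div_pow, hr3, hx, div_self haL]
  have hw1 : r / x ≠ 1 := by
    intro h
    apply hrx
    rwa [div_eq_one_iff_eq hx0] at h
  have hfac : (r / x - 1) * ((r / x) ^ 2 + r / x + 1) = 0 := by
    have : (r / x - 1) * ((r / x) ^ 2 + r / x + 1) = (r / x) ^ 3 - 1 := by ring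
    rw [this, hw3, sub_self]
  rcases mul_eq_zero.mp hfac with h | h
  · exact absurd (sub_eq_zero.mp h) hw1
  · exact h

/-- **No cube root of `432p²` in a normal `L/ℚ` with `ω ∉ L`.** [folklore] -/
theorem cube_ne_432_mul_sq_of_normal {p : ℕ} (hp : p.Prime) (hp2 : p ≠ 2)
    (L : Type u) [Field L] [Algebra ℚ L] [Normal ℚ L] (hω : ∀ w : L, w ^ 2 + w + 1 ≠ 0)
    (x : L) : x ^ 3 ≠ algebraMap ℚ L (432 * (p : ℚ) ^ 2) := fun hx => by
  obtain ⟨w, hw⟩ := exists_sq_add_self_add_one_eq_zero_of_cube_eq hp hp2 L hx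
  exact hω w hw

/-! ## §3 `E_p(L)[2] = 0` for every normal `L/ℚ` not containing `ω` -/

/-- **Admissibility input of stub (d) at `p = 2` (Gross Lemma 4.3 replacement for the Sylvester
curves): for every model `W` of `E_p` (`p` an odd prime) and every NORMAL extension `L/ℚ` with
`ω ∉ L` — e.g. the ring class fields `K_m` of a Heegner field at the Kolyvagin levels — `W(L)` has no
point of order `2`.**  [cite: GrossLMS1991, Lemma 4.3] [cite: McCallumLMS1991, §4 (5)] -/
theorem two_torsion_eq_zero_of_model_of_normal {p : ℕ} (hp : p.Prime) (hp2 : p ≠ 2)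
    (W : WeierstrassCurve ℚ) (hW : ∃ C : VariableChange ℚ, C • W = cubeSumCurve (p : ℚ))
    (L : Type u) [Field L] [Algebra ℚ L] [Normal ℚ L] (hω : ∀ w : L, w ^ 2 + w + 1 ≠ 0)
    (Q : (W.baseChange L).toAffine.Point) (hQ : 2 • Q = 0) : Q = 0 := by
  haveI : CharZero L := charZero_of_injective_algebraMap (algebraMap ℚ L).injective
  exact two_torsion_eq_zero_of_model_of_no_cube_root p W hW L
    (cube_ne_432_mul_sq_of_normal hp hp2 L hω) Q hQ

end Summit.BirchSwinnertonDyer.BirchSwinnertonDyer.Theorems.SylvesterTwoUpper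

end
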